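import Summits.HodgeConjecture.HodgeConjecture.Theses.MilnorKExponential
import Literature.AlgebraicGeometry.HodgeTheory.ComplexGysin
import Literature.AlgebraicGeometry.HodgeTheory.ComplexConjugationHolds
import Literature.AlgebraicGeometry.Motives.VarietiesProjectiveSpaceProofs

/-!
# Refutation of `MilnorKExponential.SymbolLift` (refuted-misstated)

The inlined symbol-class predicate of route `MilnorKExponential` carries a NORMALISATION clause
asking, in the SAME degree `2(q+1)` as the class `c`, for a holomorphic line bundle whose
`c₁`-power symbol cocycle transgresses to a NON-ZERO rational class `c₀ : H^{2(q+1)}(X(ℂ); ℂ)`.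
Above the dimension (`q + 1 > dim X`) that group vanishes
(`Literature.AlgebraicGeometry.HodgeTheory.subsingleton_complexBetti`), so NO class — not even
`c = 0`, which is rational and of Hodge type `(q+1, q+1)` — is a symbol class there, while
`SymbolLift` demands it for every rational `(q+1,q+1)` class.  Witness: `X = ℙ⁰_ℂ` (a point,
`isSmoothProjective_projectiveSpace_holds ℂ 0`), `q = 0`, `c = 0 ∈ H²(pt; ℂ) = 0`.
-/

namespace Summit.HodgeConjecture.HodgeConjecture.Theses.MilnorKExponential
open scoped BigOperators Topology Manifold Classical MeasureTheory ProbabilityTheory Matrix InnerProductSpace ComplexConjugate ContinuousMap in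
open Filter Set Function TopologicalSpace MeasureTheory in
/-- **Record of the dropped route item `SymbolLift`** = stmt-HodgeConjecture-17744 (ledger signature verbatim; NOT a route
item): route MilnorKExponential (2026-08-17T02:58Z) dropped the refuted `SymbolLift`. The declaration `Summit.HodgeConjecture.HodgeConjecture.Theses.MilnorKExponential.SymbolLift`
therefore no longer exists in the route file and this accepted module stopped elaborating (stale olean;
buildfix lane 2026-08-19). Re-created here under its original name so the result keeps building; the
statement of every previously accepted declaration in this file is unchanged. -/
def SymbolLift : Prop :=
  ∀ ⦃n : ℕ⦄ ⦃X : Literature.AlgebraicGeometry.Motives.SchemeOver ℂ⦄, Literature.AlgebraicGeometry.Motives.IsSmoothProjective n X → ∀ (q : ℕ) (c : Literature.AlgebraicGeometry.HodgeTheory.complexBetti X (2 * (q + 1))), Literature.AlgebraicGeometry.HodgeTheory.IsRationalClass c → Literature.AlgebraicGeometry.HodgeTheory.IsOfHodgeType n X (2 * (q + 1)) (q + 1) (q + 1) c → (∃ A : Literature.AlgebraicGeometry.HodgeTheory.HodgeModel n X, let F : ℕ → Type := fun k ↦ Literature.Geometry.Kaehler.MForm 𝓘(ℝ, A.model) A.carrier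 ℂ k; let CF := Literature.NumberTheory.Transcendental.cclosedSmoothForms A.model A.carrier (2 * q + 1 + 1); let MK := Literature.NumberTheory.Transcendental.complexDeRhamCohomology.mk A.model A.carrier (2 * q + 1 + 1); let DR := A.deRham A.carrier (2 * q + 1 + 1); let T : Type := Fin (q + 1) → (A.carrier → ℂ); let IsU : Set A.carrier → (A.carrier → ℂ) → Prop := fun W f ↦ MDifferentiableOn 𝓘(ℂ, A.model) 𝓘(ℂ, ℂ) f W ∧ ∀ x ∈ W, f x ≠ 0; let Good : Set A.carrier → T → Prop := fun W t ↦ ∀ i, IsU W (t i); let Rel : Set A.carrier → AddSubgroup (T →₀ ℤ) := fun W ↦ AddSubgroup.closure ({s : T →₀ ℤ | ∃ t t' : T, Good W t ∧ Good W t' ∧ (∀ i, ∀ x ∈ W, t i x = t' i x) ∧ s = Finsupp.single t 1 - Finsupp.single t' 1} ∪ {s : T →₀ ℤ | ∃ (t : T) (i : Fin (q + 1)) (g : A.carrier → ℂ), Good W t ∧ IsU W g ∧ s = Finsupp.single (Function.update t i (t i * g)) 1 - Finsupp.single t 1 - Finsupp.single (Function.update t i g) 1} ∪ {s : T →₀ ℤ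 | ∃ (t : T) (i j : Fin (q + 1)), Good W t ∧ i ≠ j ∧ (∀ x ∈ W, t i x + t j x = 1) ∧ s = Finsupp.single t 1}); let DW : T → F (q + 1) := fun t ↦ Fin.hIterate (fun k : ℕ ↦ F k) (Literature.Geometry.Kaehler.MForm.ofFun 𝓘(ℝ, A.model) (fun _ : A.carrier ↦ (1 : ℂ))) (fun (i : Fin (q + 1)) (acc : F (i : ℕ)) ↦ Literature.Geometry.Kaehler.MForm.wedge acc (fun x : A.carrier ↦ (t i x)⁻¹ • Literature.Geometry.Kaehler.mextDeriv (Literature.Geometry.Kaehler.MForm.ofFun 𝓘(ℝ, A.model) (t i)) x)); let SF : (T →₀ ℤ) → F (q + 1) := fun σ ↦ Finsupp.sum σ fun (t : T) (z : ℤ) ↦ z • DW t; let Tr : (ι : Type) → (U : ι → Set A.carrier) → (∀ i, IsOpen (U i)) → ((Fin (q + 2) → ι) → F (q + 1)) → F (2 * q + 1 + 1) → Prop := fun ι U hU w θ ↦ ∃ Z : (a b : ℕ) → Literature.Geometry.Kaehler.CechForms 𝓘(ℝ, A.model) ℂ U a b, (∀ (J : Fin (q + 2) → ι), ∀ x ∈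 Literature.Geometry.Kaehler.cechSet U J, ((Literature.Geometry.Kaehler.cechδ 𝓘(ℝ, A.model) ℂ hU q (q + 1) (Z q (q + 1)) J : F (q + 1)) x = w J x)) ∧ (∀ a b : ℕ, a + 1 + b = 2 * q + 1 → a < q → Literature.Geometry.Kaehler.cechd 𝓘(ℝ, A.model) ℂ hU (a + 1) b (Z (a + 1) b) = Literature.Geometry.Kaehler.cechδ 𝓘(ℝ, A.model) ℂ hU a (b + 1) (Z a (b + 1))) ∧ (∀ (J : Fin 1 → ι), ∀ x ∈ Literature.Geometry.Kaehler.cechSet U J, ((Literature.Geometry.Kaehler.cechd 𝓘(ℝ, A.model) ℂ hU 0 (2 * q + 1) (Z 0 (2 * q + 1)) J : F (2 * q + 1 + 1)) x = θ x)); (∃ (ι : Type) (_ : Fintype ι) (L : Literature.Geometry.Kaehler.HolomorphicLineBundle ι A.model A.carrier) (θ₀ : CF) (c₀ : Literature.AlgebraicGeometry.HodgeTheory.complexBetti X (2 * q + 1 + 1)), Tr ι L.baseSet L.isOpen_baseSet (fun J ↦ SF (Finsupp.single (fun i : Fin (q + 1) ↦ L.coordChange (J (Fin.castSucc i)) (J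 i.succ)) 1)) θ₀ ∧ Literature.AlgebraicGeometry.HodgeTheory.IsRationalClass c₀ ∧ c₀ ≠ 0 ∧ DR (MK θ₀) = A.pullback (2 * q + 1 + 1) c₀) ∧ (∃ (ι : Type) (_ : Fintype ι) (U : ι → Set A.carrier) (hU : ∀ i, IsOpen (U i)) (_ : ∀ x, ∃ i, x ∈ U i) (σ : (Fin (q + 2) → ι) → (T →₀ ℤ)) (_ : ∀ J, ∀ t ∈ (σ J).support, Good (Literature.Geometry.Kaehler.cechSet U J) t) (_ : ∀ J' : Fin (q + 3) → ι, (∑ j : Fin (q + 3), ((-1 : ℤ) ^ (j : ℕ)) • σ (J' ∘ Fin.succAbove j)) ∈ Rel (Literature.Geometry.Kaehler.cechSet U J')) (θ : CF) (m : ℤ), m ≠ 0 ∧ Tr ι U hU (fun J ↦ SF (σ J)) θ ∧ DR (MK θ) = (m : ℂ) • A.pullback (2 * q + 1 + 1) c))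
end Summit.HodgeConjecture.HodgeConjecture.Theses.MilnorKExponential


namespace Summit.HodgeConjecture.HodgeConjecture.Theorems

open Literature.AlgebraicGeometry.HodgeTheory Literature.AlgebraicGeometry.Motives

set_option linter.dupNamespace false in
/-- Refutes `MilnorKExponential.SymbolLift` [refuted-misstated]: the normalisation clause of the
inlined `IsSymbolClass` requires a non-zero rational class `c₀` in `H^{2(q+1)}(X(ℂ); ℂ)`, which is
the zero group when `q + 1 > dim X`; but `c = 0` is a rational `(q+1,q+1)` class there, so the lift
fails.  Witness: `X = ℙ⁰_ℂ`, `n = 0`, `q = 0`, `c = 0`.  Repaired statement C′: the same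
signature with the extra hypothesis `q + 1 ≤ n` after `∀ (q : ℕ)` (LIFT only in degrees
`2(q+1) ≤ 2 dim X`, the range where `closes` needs it — above the dimension
`IsOfHodgeType.eq_zero_of_two_mul_lt` and `Submodule.zero_mem` finish HC); alternatively normalise
in degree `2` by `c₁(L)` itself.  The witness misses C′. [folklore] -/
theorem MilnorKExponentialSymbolLift_refuted :
    ¬ Summit.HodgeConjecture.HodgeConjecture.Theses.MilnorKExponential.SymbolLift := by
  intro h
  have hX : Literature.AlgebraicGeometry.Motives.IsSmoothProjective 0
      (Literature.AlgebraicGeometry.Motives.projectiveSpace 0 ℂ) :=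
    Literature.AlgebraicGeometry.Motives.isSmoothProjective_projectiveSpace_holds ℂ 0
  obtain ⟨A⟩ := Literature.AlgebraicGeometry.HodgeTheory.nonempty_hodgeModel_holds hX
  obtain ⟨A', hnorm, -⟩ := h hX 0 0 Literature.AlgebraicGeometry.HodgeTheory.IsRationalClass.zero
    (Literature.AlgebraicGeometry.HodgeTheory.IsOfHodgeType.zero A _ _ _)
  obtain ⟨ι, _, L, θ₀, c₀, -, -, hc₀, -⟩ := hnorm
  haveI : Subsingleton (Literature.AlgebraicGeometry.HodgeTheory.complexBetti
      (Literature.AlgebraicGeometry.Motives.projectiveSpace 0 ℂ) (2 * 0 + 1 + 1)) :=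
    Literature.AlgebraicGeometry.HodgeTheory.subsingleton_complexBetti hX (by norm_num)
  exact hc₀ (Subsingleton.elim _ _)

end Summit.HodgeConjecture.HodgeConjecture.Theorems
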